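import Mathlib
import Summits.ResolutionOfSingularities.ResolutionOfSingularities.Theorems.HomologicalConductorPersistenceBranchedCoverIterate
import HarnessLib

/-!
# The centre of K-C3: `ca(k⟦z,t⟧⟦u⟧⟦v⟧/(g + u² + v²)) = (v̄, ū) + J₀·T` when `ca(k⟦z,t⟧/(g)) = J₀·(k⟦z,t⟧/(g))`
# (W4.4b F-DP part 4 = K-C3 §H2L piece K2, modulo the named facts)

Route `ResolutionOfSingularities/HomologicalConductor`, chain W4.4b (cell `res-hironaka`), crux `Persistence`
(stmt-ResolutionOfSingularities-16484), KILL CANDIDATE K-C3 (res-L1-w44b-plan-1 2026-08-27T11:02:50Z; CUTS 11:12:39Z (1):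
«the COROLLARY we need verbatim: (x, y, z², zt, t²) ⊆ ca(k⟦x,y,z,t⟧/(xy − z³ − t⁴)) ∧ ca ⊆ that ideal given 𝔠(z³+t⁴) = 𝔪²»).
[OURS; AI-written, weaker than expert review; NOT a statement of the manuscript under study (Hironaka 2017), and no statement of
that manuscript is used.]

Setting (parts 2–3, p526344 / `…BranchedCoverIterate`): `S` a commutative ring, `g ∈ S`, `S₁ = S⟦u⟧`, the iterated double cover
`T = S⟦u⟧⟦v⟧/(g + u² + v²) = BranchedCover S₁ (C g + u²) 2` with projections `π₂ : T → S⟦u⟧/(g + u²)` (`v ↦ 0`) and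
`π₁ : S⟦u⟧/(g + u²) → S/(g)` (`u ↦ 0`).  This file proves:

* `comap_proj_map_eq_map` / `comap_proj_map_eq_span_sup_map` — PURE ALGEBRA (any `S`, any ideal `J₀ ≤ S`):
  `(π₁ ∘ π₂)⁻¹(J₀·(S/(g))) = (v̄, ū) ⊔ J₀·T` (`J₀·T` = the extension of `J₀` along `S → S⟦u⟧⟦v⟧ → T`); the point is `⊆`:
  an element with double constant coefficient in `J₀ + (g)` differs from a lift of `J₀` by multiples of `u`, `v` and of
  `g = −(u² + v²)` in `T`;
* **`cohomologyAnnihilator_doubleDoubleCover_eq_span_sup_map`** — for `S = k⟦x₁,…,xₙ⟧`, `char k ≠ 2`, `0 ≠ g ∈ 𝔪_S`, modulo the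
  named fact [Esentepe2020, Thm. 5.4] (`hE`) AND a description `hca : ca(S/(g)) = J₀·(S/(g))` of the curve/hypersurface side:
  **`ca(T) = (v̄, ū) ⊔ J₀·T`** (part 3's `ca(T) = (π₁ ∘ π₂)⁻¹(ca(S/(g)))` + the lemma);
* **`cohomologyAnnihilator_doubleDoubleCover_planeCurve_eq_span_sup_span`** — `n = 2`, `J₀ = (z, t)²`:
  **`ca(k⟦z,t⟧⟦u⟧⟦v⟧/(g + u² + v²)) = (v̄, ū) ⊔ (z̄², z̄t̄, t̄²)`** given `hca : ca(k⟦z,t⟧/(g)) = (z,t)²·(k⟦z,t⟧/(g))` — BOTH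
  inclusions of the K-C3 centre at once.  Instance: `g = −(z³ + t⁴)` (so `T ≅ k⟦x,y,z,t⟧/(xy − z³ − t⁴)`, `x = u + iv`,
  `y = u − iv`, `char ≠ 2`), where `hca` is [Esentepe2020, Thm. 4.4] (`planeCurve_cohomologyAnnihilator_eq_conductor`, p525400)
  plus the conductor computation `𝔠(z³ + t⁴) = 𝔪²` (semigroup `⟨3,4⟩`, conductor `6`) — carried as the HYPOTHESIS `hca`
  (planner 11:12:39Z: «if the conductor computation is not kernel-cheap, leave it as a named hypothesis and say so»: it is not —
  it needs the normalisation of a power-series quotient through `integralClosure`/`FractionRing`).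

So the K-C3 centre is kernel MODULO exactly: Esentepe Thm 5.4 (`m = 2`), the curve-side identity `hca`, and the coordinate change
`xy − h ↔ u² + v² − h`.  Filed `--supports stmt-ResolutionOfSingularities-16484 --as helper`.  Reference: Ö. Esentepe, J. Algebra 541
(2020), arXiv:1807.05471, Thms. 4.4, 5.4 [`Esentepe2020`].
-/

noncomputable section

-- single-problem summit: the doubled namespace component `ResolutionOfSingularities` is forced
set_option linter.dupNamespace false

namespace Summit.ResolutionOfSingularities.ResolutionOfSingularities.Theorems.HomologicalConductor.PersistenceDoubleDoubleCoverCentre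

open PowerSeries Literature.RingTheory.CohomologyAnnihilator
open Summit.ResolutionOfSingularities.ResolutionOfSingularities.Theorems.HomologicalConductor.PersistenceBranchedCover
open Summit.ResolutionOfSingularities.ResolutionOfSingularities.Theorems.HomologicalConductor.PersistenceBranchedCoverIterate

universe u

section Algebra

variable {S : Type u} [CommRing S]

/-- Upstairs in `S⟦u⟧⟦v⟧`: `C (C g) ∈ (v, u) ⊔ (g + u² + v²)` — indeed `C (C g) = (C (C g + u²) + v²) − ((C u)² + v²)`.
[folklore] -/
theorem C_C_mem_span_sup_span (g : S) :
    (C (C g) : PowerSeries (PowerSeries S)) ∈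
      Ideal.span {(X : PowerSeries (PowerSeries S)), C X} ⊔
        Ideal.span {(C (C g + X ^ 2 : PowerSeries S) + X ^ 2 : PowerSeries (PowerSeries S))} := by
  have h : (C (C g) : PowerSeries (PowerSeries S)) =
      (C (C g + X ^ 2 : PowerSeries S) + X ^ 2) - (C X * C X + X * X) := by
    rw [map_add, map_pow]; ring
  rw [h]
  refine Ideal.sub_mem _ (Ideal.mem_sup_right (Ideal.mem_span_singleton_self _)) (Ideal.mem_sup_left ?_)
  exact Ideal.add_mem _ (Ideal.mul_mem_left _ _ (Ideal.subset_span (by simp)))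
    (Ideal.mul_mem_left _ _ (Ideal.subset_span (by simp)))

/-- Upstairs in `S⟦u⟧⟦v⟧`: a series whose double constant coefficient vanishes lies in `(v, u)` — `A = v·Q + C u · C P`.
[folklore] -/
theorem mem_span_of_constantCoeff_constantCoeff_eq_zero (A : PowerSeries (PowerSeries S))
    (hA : constantCoeff (constantCoeff A) = 0) :
    A ∈ Ideal.span {(X : PowerSeries (PowerSeries S)), C X} := by
  obtain ⟨Q, hQ⟩ := X_dvd_iff.mpr (show constantCoeff (A - C (constantCoeff A)) = 0 by
    rw [map_sub, constantCoeff_C, sub_self])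
  obtain ⟨P, hP⟩ := X_dvd_iff.mpr hA
  have hA' : A = X * Q + C X * C P := by
    rw [← map_mul, ← hP, ← hQ, sub_add_cancel]
  rw [hA']
  exact Ideal.add_mem _ (Ideal.mul_mem_right _ _ (Ideal.subset_span (by simp)))
    (Ideal.mul_mem_right _ _ (Ideal.subset_span (by simp)))

/-- How `π₁ ∘ π₂` acts on classes: it takes the double constant coefficient. [folklore] -/
theorem proj_comp_proj_mk (g : S) (A : PowerSeries (PowerSeries S)) :
    ((branchedCoverProjection S g 2).comp
        (branchedCoverProjection (PowerSeries S) (C g + X ^ 2 : PowerSeries S) 2)) (Ideal.Quotient.mk _ A) =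
      Ideal.Quotient.mk (Ideal.span {g}) (constantCoeff (constantCoeff A)) := by
  rw [RingHom.comp_apply, branchedCoverProjection_mk]
  exact branchedCoverProjection_mk g 2 (constantCoeff A)

/-- **PURE ALGEBRA: the preimage of an extended ideal under `π₁ ∘ π₂`.**  For any commutative ring `S`, `g ∈ S` and ideal
`J₀ ≤ S`: `(π₁ ∘ π₂)⁻¹(J₀·(S/(g)))` is the image in `T = S⟦u⟧⟦v⟧/(g + u² + v²)` of the ideal `(v, u) ⊔ J₀·S⟦u⟧⟦v⟧`.  `⊇`: `π₁π₂`
kills `u`, `v` and maps `J₀` into `J₀·(S/(g))`.  `⊆`: if the double constant coefficient `b` of `A` has `b̄ ∈ J₀·(S/(g))`, then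
`b = j + s·g` with `j ∈ J₀`, and `A − C C j = (A − C C b) + C C s · C C g ∈ (v, u) + (g + u² + v²)`
(`mem_span_of_constantCoeff_constantCoeff_eq_zero`, `C_C_mem_span_sup_span`). [folklore] -/
theorem comap_proj_map_eq_map (g : S) (J₀ : Ideal S) :
    (J₀.map (Ideal.Quotient.mk (Ideal.span {g}))).comap
        ((branchedCoverProjection S g 2).comp
          (branchedCoverProjection (PowerSeries S) (C g + X ^ 2 : PowerSeries S) 2)) =
      (Ideal.span {(X : PowerSeries (PowerSeries S)), C X} ⊔
          J₀.map ((C (R := PowerSeries S)).comp (C (R := S)))).map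
        (Ideal.Quotient.mk (Ideal.span {(C (C g + X ^ 2 : PowerSeries S) + X ^ 2 : PowerSeries (PowerSeries S))})) := by
  apply le_antisymm
  · intro a ha
    obtain ⟨A, rfl⟩ := Ideal.Quotient.mk_surjective a
    rw [Ideal.mem_comap, proj_comp_proj_mk] at ha
    -- `constantCoeff (constantCoeff A) ∈ J₀ ⊔ (g)`
    have hb : constantCoeff (constantCoeff A) ∈ J₀ ⊔ Ideal.span {g} := by
      have := Ideal.mem_comap.mpr ha
      rwa [Ideal.comap_map_of_surjective _ Ideal.Quotient.mk_surjective, ← RingHom.ker_eq_comap_bot,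
        Ideal.mk_ker] at this
    obtain ⟨j, hj, c, hc, hjc⟩ := Submodule.mem_sup.mp hb
    obtain ⟨s, rfl⟩ := Ideal.mem_span_singleton'.mp hc
    -- `A = (A - C C b) + C C j + C C s * C C g`, each summand in `(v, u) ⊔ J₀·S⟦u⟧⟦v⟧ ⊔ (generator)`
    have hsplit : A = (A - C (C (constantCoeff (constantCoeff A)))) + C (C j) + C (C s) * C (C g) := by
      rw [← hjc, map_add, map_add, map_mul, map_mul]; ring
    have hmem : A ∈ (Ideal.span {(X : PowerSeries (PowerSeries S)), C X} ⊔
        J₀.map ((C (R := PowerSeries S)).comp (C (R := S)))) ⊔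
        Ideal.span {(C (C g + X ^ 2 : PowerSeries S) + X ^ 2 : PowerSeries (PowerSeries S))} := by
      rw [hsplit]
      refine Ideal.add_mem _ (Ideal.add_mem _ ?_ ?_) ?_
      · exact Ideal.mem_sup_left (Ideal.mem_sup_left (mem_span_of_constantCoeff_constantCoeff_eq_zero _
          (by rw [map_sub, map_sub, constantCoeff_C, constantCoeff_C, sub_self])))
      · exact Ideal.mem_sup_left (Ideal.mem_sup_right (Ideal.mem_map_of_mem _ hj))
      · have h3 := C_C_mem_span_sup_span (S := S) g
        have hle : Ideal.span {(X : PowerSeries (PowerSeries S)), C X} ⊔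
            Ideal.span {(C (C g + X ^ 2 : PowerSeries S) + X ^ 2 : PowerSeries (PowerSeries S))} ≤
            (Ideal.span {(X : PowerSeries (PowerSeries S)), C X} ⊔
              J₀.map ((C (R := PowerSeries S)).comp (C (R := S)))) ⊔
            Ideal.span {(C (C g + X ^ 2 : PowerSeries S) + X ^ 2 : PowerSeries (PowerSeries S))} :=
          sup_le_sup_right le_sup_left _
        exact Ideal.mul_mem_left _ _ (hle h3)
    have := Ideal.mem_map_of_mem (Ideal.Quotient.mk
      (Ideal.span {(C (C g + X ^ 2 : PowerSeries S) + X ^ 2 : PowerSeries (PowerSeries S))})) hmem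
    rwa [Ideal.map_sup, Ideal.map_quotient_self, sup_bot_eq] at this
  · rw [Ideal.map_le_iff_le_comap]
    refine sup_le ?_ ?_
    · rw [Ideal.span_le]
      rintro x hx
      simp only [Set.mem_insert_iff, Set.mem_singleton_iff] at hx
      rw [SetLike.mem_coe, Ideal.mem_comap, Ideal.mem_comap, proj_comp_proj_mk]
      rcases hx with rfl | rfl
      · rw [constantCoeff_X, map_zero, map_zero]; exact Ideal.zero_mem _
      · rw [constantCoeff_C, constantCoeff_X, map_zero]; exact Ideal.zero_mem _
    · rw [Ideal.map_le_iff_le_comap]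
      intro j hj
      rw [Ideal.mem_comap, Ideal.mem_comap, Ideal.mem_comap]
      change ((branchedCoverProjection S g 2).comp
        (branchedCoverProjection (PowerSeries S) (C g + X ^ 2 : PowerSeries S) 2)) (Ideal.Quotient.mk _ (C (C j))) ∈ _
      rw [proj_comp_proj_mk, constantCoeff_C, constantCoeff_C]
      exact Ideal.mem_map_of_mem _ hj

/-- The same with the right-hand side written inside `T`: `(π₁ ∘ π₂)⁻¹(J₀·(S/(g))) = (v̄, ū) ⊔ J₀·T`. [folklore] -/
theorem comap_proj_map_eq_span_sup_map (g : S) (J₀ : Ideal S) :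
    (J₀.map (Ideal.Quotient.mk (Ideal.span {g}))).comap
        ((branchedCoverProjection S g 2).comp
          (branchedCoverProjection (PowerSeries S) (C g + X ^ 2 : PowerSeries S) 2)) =
      Ideal.span {Ideal.Quotient.mk (Ideal.span {(C (C g + X ^ 2 : PowerSeries S) + X ^ 2 : PowerSeries (PowerSeries S))}) X,
          Ideal.Quotient.mk (Ideal.span {(C (C g + X ^ 2 : PowerSeries S) + X ^ 2 : PowerSeries (PowerSeries S))}) (C X)} ⊔
        J₀.map ((Ideal.Quotient.mk
            (Ideal.span {(C (C g + X ^ 2 : PowerSeries S) + X ^ 2 : PowerSeries (PowerSeries S))})).comp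
          ((C (R := PowerSeries S)).comp (C (R := S)))) := by
  rw [comap_proj_map_eq_map, Ideal.map_sup, Ideal.map_span, Set.image_pair, Ideal.map_map]

end Algebra

/-! ## The centre, modulo the named fact and the curve-side identity -/

/-- **`ca(T) = (v̄, ū) ⊔ J₀·T`** for `T = S⟦u⟧⟦v⟧/(g + u² + v²)`, `S = k⟦x₁,…,xₙ⟧`, `char k ≠ 2`, `0 ≠ g ∈ 𝔪_S` — modulo the named fact
[Esentepe2020, Thm. 5.4, `m = 2`] (`hE`) and a description `hca : ca(S/(g)) = J₀·(S/(g))` of the base: part 3's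
`ca(T) = (π₁ ∘ π₂)⁻¹(ca(S/(g)))` and `comap_proj_map_eq_span_sup_map`. [cite: Esentepe2020, Theorem 5.4 (consequence)] -/
theorem cohomologyAnnihilator_doubleDoubleCover_eq_span_sup_map
    (hE : doubleBranchedCover_map_cohomologyAnnihilator_eq.{u}) (k : Type u) [Field k] (hchar : ringChar k ≠ 2) (n : ℕ)
    (g : MvPowerSeries (Fin n) k) (hg : MvPowerSeries.constantCoeff g = 0) (hg0 : g ≠ 0) (J₀ : Ideal (MvPowerSeries (Fin n) k))
    (hca : cohomologyAnnihilator (MvPowerSeries (Fin n) k ⧸ Ideal.span {g}) = J₀.map (Ideal.Quotient.mk (Ideal.span {g}))) :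
    cohomologyAnnihilator
        (BranchedCover (PowerSeries (MvPowerSeries (Fin n) k)) (C g + X ^ 2 : PowerSeries (MvPowerSeries (Fin n) k)) 2) =
      Ideal.span {Ideal.Quotient.mk (Ideal.span {(C (C g + X ^ 2 : PowerSeries (MvPowerSeries (Fin n) k)) + X ^ 2 :
            PowerSeries (PowerSeries (MvPowerSeries (Fin n) k)))}) X,
          Ideal.Quotient.mk (Ideal.span {(C (C g + X ^ 2 : PowerSeries (MvPowerSeries (Fin n) k)) + X ^ 2 :
            PowerSeries (PowerSeries (MvPowerSeries (Fin n) k)))}) (C X)} ⊔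
        J₀.map ((Ideal.Quotient.mk (Ideal.span {(C (C g + X ^ 2 : PowerSeries (MvPowerSeries (Fin n) k)) + X ^ 2 :
            PowerSeries (PowerSeries (MvPowerSeries (Fin n) k)))})).comp
          ((C (R := PowerSeries (MvPowerSeries (Fin n) k))).comp (C (R := MvPowerSeries (Fin n) k)))) := by
  rw [cohomologyAnnihilator_doubleDoubleCover_eq_comap hE k hchar n g hg hg0, hca]
  exact comap_proj_map_eq_span_sup_map g J₀

/-- `(z, t)² = (z², z·t, t²)` in any commutative ring. [folklore] -/
theorem span_pair_sq {R : Type u} [CommRing R] (z t : R) :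
    (Ideal.span {z, t}) ^ 2 = Ideal.span {z ^ 2, z * t, t ^ 2} := by
  rw [sq, Ideal.span_pair_mul_span_pair, mul_comm t z, Set.insert_idem, ← sq, ← sq]

/-- **THE K-C3 CENTRE (plane-curve base, `u² + v²` coordinates) [OURS · F-DP part 4]:** for `S = k⟦z,t⟧ = MvPowerSeries (Fin 2) k`
(`z = X 0`, `t = X 1`), `char k ≠ 2`, `0 ≠ g ∈ 𝔪_S`, and `T = S⟦u⟧⟦v⟧/(g + u² + v²)`:  IF `ca(S/(g)) = (z,t)²·(S/(g))` (hypothesis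
`hca` — for `g = ∓(z³ + t⁴)` this is [Esentepe2020, Thm. 4.4] `ca = 𝔠` (`planeCurve_cohomologyAnnihilator_eq_conductor`) with
`𝔠(z³+t⁴) = 𝔪²`, the conductor of the semigroup `⟨3, 4⟩`, NOT computed here) THEN, modulo [Esentepe2020, Thm. 5.4] (`hE`),
**`ca(T) = (v̄, ū) ⊔ (z̄², z̄·t̄, t̄²)`** — the lower bound `(u, v, z², zt, t²) ⊆ ca` and the upper bound `ca ⊆ (u, v, z², zt, t²)`
of the K-C3 centre at once (`x = u + iv`, `y = u − iv` recovers `k⟦x,y,z,t⟧/(xy + g)`).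
[cite: Esentepe2020, Theorems 4.4 and 5.4 (consequence)] -/
theorem cohomologyAnnihilator_doubleDoubleCover_planeCurve_eq_span_sup_span
    (hE : doubleBranchedCover_map_cohomologyAnnihilator_eq.{u}) (k : Type u) [Field k] (hchar : ringChar k ≠ 2)
    (g : MvPowerSeries (Fin 2) k) (hg : MvPowerSeries.constantCoeff g = 0) (hg0 : g ≠ 0)
    (hca : cohomologyAnnihilator (MvPowerSeries (Fin 2) k ⧸ Ideal.span {g}) =
      ((Ideal.span {(MvPowerSeries.X 0 : MvPowerSeries (Fin 2) k), MvPowerSeries.X 1}) ^ 2).map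
        (Ideal.Quotient.mk (Ideal.span {g}))) :
    cohomologyAnnihilator
        (BranchedCover (PowerSeries (MvPowerSeries (Fin 2) k)) (C g + X ^ 2 : PowerSeries (MvPowerSeries (Fin 2) k)) 2) =
      Ideal.span {Ideal.Quotient.mk (Ideal.span {(C (C g + X ^ 2 : PowerSeries (MvPowerSeries (Fin 2) k)) + X ^ 2 :
            PowerSeries (PowerSeries (MvPowerSeries (Fin 2) k)))}) X,
          Ideal.Quotient.mk (Ideal.span {(C (C g + X ^ 2 : PowerSeries (MvPowerSeries (Fin 2) k)) + X ^ 2 :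
            PowerSeries (PowerSeries (MvPowerSeries (Fin 2) k)))}) (C X)} ⊔
      Ideal.span {Ideal.Quotient.mk (Ideal.span {(C (C g + X ^ 2 : PowerSeries (MvPowerSeries (Fin 2) k)) + X ^ 2 :
            PowerSeries (PowerSeries (MvPowerSeries (Fin 2) k)))}) (C (C (MvPowerSeries.X 0 ^ 2))),
          Ideal.Quotient.mk (Ideal.span {(C (C g + X ^ 2 : PowerSeries (MvPowerSeries (Fin 2) k)) + X ^ 2 :
            PowerSeries (PowerSeries (MvPowerSeries (Fin 2) k)))}) (C (C (MvPowerSeries.X 0 * MvPowerSeries.X 1))),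
          Ideal.Quotient.mk (Ideal.span {(C (C g + X ^ 2 : PowerSeries (MvPowerSeries (Fin 2) k)) + X ^ 2 :
            PowerSeries (PowerSeries (MvPowerSeries (Fin 2) k)))}) (C (C (MvPowerSeries.X 1 ^ 2)))} := by
  rw [cohomologyAnnihilator_doubleDoubleCover_eq_span_sup_map hE k hchar 2 g hg hg0 _ hca, span_pair_sq, Ideal.map_span,
    Set.image_insert_eq, Set.image_insert_eq, Set.image_singleton]
  rfl

/-! ## The sign bridge: base `S/(h)`, cover `S⟦u⟧⟦v⟧/(−h + u² + v²)` (the `xy − h` convention of K-C3) -/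

/-- Transfer of a description `ca(S/I) = K·(S/I)` along an EQUALITY of ideals `I = J` (used with `(−h) = (h)`). [folklore] -/
theorem cohomologyAnnihilator_quotient_eq_map_of_eq {S : Type u} [CommRing S] {I J : Ideal S} (hIJ : I = J) (K : Ideal S)
    (h : cohomologyAnnihilator (S ⧸ I) = K.map (Ideal.Quotient.mk I)) :
    cohomologyAnnihilator (S ⧸ J) = K.map (Ideal.Quotient.mk J) := by
  subst hIJ
  exact h

/-- **THE K-C3 CENTRE in the `xy − h` SIGN CONVENTION [OURS · F-DP part 4b]:** for `S = k⟦z,t⟧`, `char k ≠ 2`, `0 ≠ h ∈ 𝔪_S` and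
`T = S⟦u⟧⟦v⟧/(−h + u² + v²)` (`≅ k⟦x,y,z,t⟧/(xy − h)` under `x = u + iv`, `y = u − iv`, `i² = −1` — the convention of
res-D-pv-058's p527448 and res-type-010's p527657 for `h = z³ + t⁴`): IF `ca(S/(h)) = (z,t)²·(S/(h))` (hypothesis `hca`, stated for
`+h`: [Esentepe2020, Thm. 4.4] + the conductor of the curve) THEN, modulo [Esentepe2020, Thm. 5.4] (`hE`),
**`ca(T) = (v̄, ū) ⊔ (z̄², z̄·t̄, t̄²)`**.  (`(−h) = (h)` as ideals, `Ideal.span_singleton_neg`.)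
[cite: Esentepe2020, Theorems 4.4 and 5.4 (consequence)] -/
theorem cohomologyAnnihilator_doubleDoubleCover_planeCurve_neg_eq_span_sup_span
    (hE : doubleBranchedCover_map_cohomologyAnnihilator_eq.{u}) (k : Type u) [Field k] (hchar : ringChar k ≠ 2)
    (h : MvPowerSeries (Fin 2) k) (hh : MvPowerSeries.constantCoeff h = 0) (hh0 : h ≠ 0)
    (hca : cohomologyAnnihilator (MvPowerSeries (Fin 2) k ⧸ Ideal.span {h}) =
      ((Ideal.span {(MvPowerSeries.X 0 : MvPowerSeries (Fin 2) k), MvPowerSeries.X 1}) ^ 2).map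
        (Ideal.Quotient.mk (Ideal.span {h}))) :
    cohomologyAnnihilator
        (BranchedCover (PowerSeries (MvPowerSeries (Fin 2) k)) (C (-h) + X ^ 2 : PowerSeries (MvPowerSeries (Fin 2) k)) 2) =
      Ideal.span {Ideal.Quotient.mk (Ideal.span {(C (C (-h) + X ^ 2 : PowerSeries (MvPowerSeries (Fin 2) k)) + X ^ 2 :
            PowerSeries (PowerSeries (MvPowerSeries (Fin 2) k)))}) X,
          Ideal.Quotient.mk (Ideal.span {(C (C (-h) + X ^ 2 : PowerSeries (MvPowerSeries (Fin 2) k)) + X ^ 2 :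
            PowerSeries (PowerSeries (MvPowerSeries (Fin 2) k)))}) (C X)} ⊔
      Ideal.span {Ideal.Quotient.mk (Ideal.span {(C (C (-h) + X ^ 2 : PowerSeries (MvPowerSeries (Fin 2) k)) + X ^ 2 :
            PowerSeries (PowerSeries (MvPowerSeries (Fin 2) k)))}) (C (C (MvPowerSeries.X 0 ^ 2))),
          Ideal.Quotient.mk (Ideal.span {(C (C (-h) + X ^ 2 : PowerSeries (MvPowerSeries (Fin 2) k)) + X ^ 2 :
            PowerSeries (PowerSeries (MvPowerSeries (Fin 2) k)))}) (C (C (MvPowerSeries.X 0 * MvPowerSeries.X 1))),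
          Ideal.Quotient.mk (Ideal.span {(C (C (-h) + X ^ 2 : PowerSeries (MvPowerSeries (Fin 2) k)) + X ^ 2 :
            PowerSeries (PowerSeries (MvPowerSeries (Fin 2) k)))}) (C (C (MvPowerSeries.X 1 ^ 2)))} :=
  cohomologyAnnihilator_doubleDoubleCover_planeCurve_eq_span_sup_span hE k hchar (-h)
    (by rw [map_neg, hh, neg_zero]) (neg_ne_zero.mpr hh0)
    (cohomologyAnnihilator_quotient_eq_map_of_eq (Ideal.span_singleton_neg h).symm _ hca)

end Summit.ResolutionOfSingularities.ResolutionOfSingularities.Theorems.HomologicalConductor.PersistenceDoubleDoubleCoverCentre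

end
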